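import Mathlib
import HarnessLib
import Literature.Combinatorics.SimpleGraph.LasserreStableBound
import Literature.Combinatorics.SimpleGraph.LasserreLevelOne
import Literature.Combinatorics.SimpleGraph.PaleyDegenerateModuli
import Summits.PneNP.PneNP.Theses.RamseyUncertifiable
import Summits.PneNP.PneNP.Theorems.RamseyUncertifiableThetaUncertainty

/-!
# Route `RamseyUncertifiable`, item `SosUncertainty` (stmt-PneNP-9815) — reductions and the settled cases

`SosUncertainty` (the SoS UNCERTAINTY PRINCIPLE `UP_t`) reads: for every Lasserre level `t ≥ 1`
there are `δ > 0` and `n₀` with `n ^ δ ≤ las_t(G) · las_t(Gᶜ)` for every graph `G` on `Fin n`,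
`n ≥ n₀` (`las_t = Literature.Combinatorics.SimpleGraph.lasserreStableBound`, Laurent's program (22)).
It is an open conjecture for `t ≥ 2`. This file records, sorry-free, what IS settled and the
book-keeping reductions every attack uses:

* `card_le_lasserreStableBound_one_mul` — LEVEL ONE HOLDS with `δ = 1`, `n₀ = 0`:
  `n ≤ las₁(G) · las₁(Gᶜ)` (Lovász 1979 Cor. 2 = route item `ThetaUncertainty`, proved in
  `RamseyUncertifiableThetaUncertainty.lean`, transported along `las₁ = ϑ`, `LasserreLevelOne.lean`).
* `levelUP_one` — the level-`1` instance of the conjecture in its own `∃ δ, ∃ n₀` shape.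
* `levelUP_anti` — the level-`t` statement is ANTITONE in `t` (the hierarchy only sharpens), so
* `sosUncertainty_iff_two_le` — the conjecture is exactly its `t ≥ 2` part, and
* `sosUncertainty_iff_cofinal` — it suffices to prove it along any cofinal set of levels.
* `sosUncertainty_iff_const` — the equivalent "constant" form `∃ δ > 0, ∃ c > 0, ∀ n, ∀ G,
  c · n ^ δ ≤ las_t(G) · las_t(Gᶜ)` (no threshold `n₀`; the form that is super-additive under
  disjoint unions and joins).
* `indepNum_mul_indepNum_compl_le` — the trivial floor `α(G) · α(Gᶜ) ≤ las_t(G) · las_t(Gᶜ)`.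
* `paleySosRung_of_sosUncertainty` — the rung implication recorded in the route file
  (`PaleySosRung [deps: SosUncertainty]`): the Paley graph is self-complementary for primes
  `p ≡ 1 (mod 4)` (`lasserreStableBound_compl_paleyGraph`, tree), so `UP_t` gives
  `las_t(P_p) ≥ p^{δ/2}`.

Nothing here claims progress on `t ≥ 2`; see the item's `## Census` for the state of the attack.

References: L. Lovász, *On the Shannon capacity of a graph* (1979), Cor. 2; M. Laurent,
*Strengthened semidefinite programming bounds for codes* (2007), §3.1; D. Kunisky, X. Yu,
arXiv:2211.02713 (Paley, self-complementarity Prop. 2.6).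
-/

-- the Theorems namespace `Summit.PneNP.PneNP.Theorems` is prescribed by the tree layout
set_option linter.dupNamespace false

namespace Summit.PneNP.PneNP.Theorems.SosUncertainty

open Literature.Combinatorics.SimpleGraph
open Summit.PneNP.PneNP.Theses.RamseyUncertifiable (SosUncertainty PaleySosRung)

/-! ### Level one is settled -/

/-- **Level one of `UP`** (Lovász 1979, Cor. 2, through `las₁ = ϑ`): for every graph `G` on `Fin n`,
`n ≤ las₁(G) · las₁(Gᶜ)`. -/
theorem card_le_lasserreStableBound_one_mul (n : ℕ) (G : SimpleGraph (Fin n)) :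
    (n : ℝ) ≤ lasserreStableBound G 1 * lasserreStableBound Gᶜ 1 := by
  rw [lasserreStableBound_one_eq_lovaszTheta, lasserreStableBound_one_eq_lovaszTheta]
  exact thetaUncertainty_proof n G

/-- The level-`1` instance of the conjecture, in the conjecture's own shape (`δ = 1`, `n₀ = 0`). -/
theorem levelUP_one :
    ∃ δ : ℝ, 0 < δ ∧ ∃ n₀ : ℕ, ∀ n ≥ n₀, ∀ G : SimpleGraph (Fin n),
      (n : ℝ) ^ δ ≤ lasserreStableBound G 1 * lasserreStableBound Gᶜ 1 :=
  ⟨1, one_pos, 0, fun n _ G => by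
    rw [Real.rpow_one]
    exact card_le_lasserreStableBound_one_mul n G⟩

/-! ### Monotonicity in the level and the reductions -/

/-- **The level-`t` statement is antitone in `t`**: if `UP` holds at level `t'` then it holds, with
the same `δ` and `n₀`, at every level `1 ≤ t ≤ t'` (`las_{t'} ≤ las_t`, Laurent's hierarchy). -/
theorem levelUP_anti {t t' : ℕ} (ht : 1 ≤ t) (htt' : t ≤ t') {δ : ℝ} {n₀ : ℕ}
    (h : ∀ n ≥ n₀, ∀ G : SimpleGraph (Fin n),
      (n : ℝ) ^ δ ≤ lasserreStableBound G t' * lasserreStableBound Gᶜ t') :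
    ∀ n ≥ n₀, ∀ G : SimpleGraph (Fin n),
      (n : ℝ) ^ δ ≤ lasserreStableBound G t * lasserreStableBound Gᶜ t := by
  intro n hn G
  have ht' : 1 ≤ t' := ht.trans htt'
  refine (h n hn G).trans (mul_le_mul (lasserreStableBound_anti_level ht htt')
    (lasserreStableBound_anti_level ht htt') (lasserreStableBound_nonneg Gᶜ t' ht')
    (lasserreStableBound_nonneg G t ht))

/-- **`SosUncertainty` is exactly its `t ≥ 2` part** (level `1` being Lovász's theorem). -/
theorem sosUncertainty_iff_two_le :
    SosUncertainty ↔ ∀ t : ℕ, 2 ≤ t → ∃ δ : ℝ, 0 < δ ∧ ∃ n₀ : ℕ, ∀ n ≥ n₀,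
      ∀ G : SimpleGraph (Fin n),
        (n : ℝ) ^ δ ≤ lasserreStableBound G t * lasserreStableBound Gᶜ t := by
  refine ⟨fun h t ht => h t (le_trans (by norm_num) ht), fun h t ht => ?_⟩
  rcases ht.eq_or_lt with h1 | ht2
  · subst h1
    exact levelUP_one
  · exact h t ht2

/-- **Cofinality**: `SosUncertainty` holds as soon as `UP` holds at a cofinal set of levels. -/
theorem sosUncertainty_iff_cofinal :
    SosUncertainty ↔ ∀ k : ℕ, ∃ t : ℕ, k ≤ t ∧ ∃ δ : ℝ, 0 < δ ∧ ∃ n₀ : ℕ, ∀ n ≥ n₀,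
      ∀ G : SimpleGraph (Fin n),
        (n : ℝ) ^ δ ≤ lasserreStableBound G t * lasserreStableBound Gᶜ t := by
  refine ⟨fun h k => ⟨max k 1, le_max_left _ _, h _ (le_max_right _ _)⟩, fun h t ht => ?_⟩
  obtain ⟨t', htt', δ, hδ, n₀, hn⟩ := h t
  exact ⟨δ, hδ, n₀, levelUP_anti ht htt' hn⟩

/-- `1 ≤ las_t(H)` on `n ≥ 1` vertices (`t ≥ 1`): a single vertex is a stable set. -/
theorem one_le_lasserreStableBound {n : ℕ} (hn : 1 ≤ n) (H : SimpleGraph (Fin n)) {t : ℕ}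
    (ht : 1 ≤ t) : (1 : ℝ) ≤ lasserreStableBound H t := by
  have hind : H.IsNIndepSet 1 ({(⟨0, hn⟩ : Fin n)} : Finset (Fin n)) :=
    ⟨by rw [Finset.coe_singleton]; exact Set.pairwise_singleton _ _, by simp⟩
  exact_mod_cast le_lasserreStableBound_of_isNIndepSet H t hind ht

/-- **The constant form**: `UP_t` with a threshold `n₀` is equivalent to `UP_t` with a constant,
`∃ δ > 0, ∃ c > 0, ∀ n, ∀ G, c · n ^ δ ≤ las_t(G) · las_t(Gᶜ)` (for `n < n₀` the product is `≥ 1`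
by `α ≥ 1`, and `n₀^{-δ} n^δ ≤ 1`; conversely halve `δ` and take `n₀ ≥ c^{-2/δ}`). -/
theorem sosUncertainty_iff_const :
    SosUncertainty ↔ ∀ t : ℕ, 1 ≤ t → ∃ δ : ℝ, 0 < δ ∧ ∃ c : ℝ, 0 < c ∧ ∀ n : ℕ,
      ∀ G : SimpleGraph (Fin n),
        c * (n : ℝ) ^ δ ≤ lasserreStableBound G t * lasserreStableBound Gᶜ t := by
  constructor
  · intro h t ht
    obtain ⟨δ, hδ, n₀, hn⟩ := h t ht
    -- constant `c = (n₀ + 1)^{-δ}`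
    refine ⟨δ, hδ, ((n₀ + 1 : ℕ) : ℝ) ^ (-δ), Real.rpow_pos_of_pos (by positivity) _, fun n G => ?_⟩
    rcases le_or_gt n₀ n with hle | hlt
    · -- above the threshold: `c ≤ 1`
      have hc : ((n₀ + 1 : ℕ) : ℝ) ^ (-δ) ≤ 1 :=
        Real.rpow_le_one_of_one_le_of_nonpos (by exact_mod_cast Nat.succ_le_succ (Nat.zero_le _))
          (neg_nonpos.2 hδ.le)
      calc ((n₀ + 1 : ℕ) : ℝ) ^ (-δ) * (n : ℝ) ^ δ ≤ 1 * (n : ℝ) ^ δ :=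
            mul_le_mul_of_nonneg_right hc (Real.rpow_nonneg (Nat.cast_nonneg _) _)
        _ = (n : ℝ) ^ δ := one_mul _
        _ ≤ _ := hn n hle G
    · -- below the threshold: `c n^δ ≤ 1 ≤ α(G) α(Gᶜ) ≤ product` (for `n ≥ 1`; `n = 0` is `0 ≤ _`)
      rcases Nat.eq_zero_or_pos n with rfl | hnpos
      · simp only [CharP.cast_eq_zero, Real.zero_rpow hδ.ne', mul_zero]
        exact mul_nonneg (lasserreStableBound_nonneg G t ht) (lasserreStableBound_nonneg Gᶜ t ht)
      · have h1 : ((n₀ + 1 : ℕ) : ℝ) ^ (-δ) * (n : ℝ) ^ δ ≤ 1 := by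
          rw [Real.rpow_neg (Nat.cast_nonneg _), inv_mul_le_iff₀ (Real.rpow_pos_of_pos (by positivity) _),
            mul_one]
          exact Real.rpow_le_rpow (Nat.cast_nonneg _) (by exact_mod_cast (Nat.le_succ_of_le hlt.le)) hδ.le
        have hα : (1 : ℝ) ≤ lasserreStableBound G t := one_le_lasserreStableBound hnpos G ht
        have hα' : (1 : ℝ) ≤ lasserreStableBound Gᶜ t := one_le_lasserreStableBound hnpos Gᶜ ht
        calc ((n₀ + 1 : ℕ) : ℝ) ^ (-δ) * (n : ℝ) ^ δ ≤ 1 := h1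
          _ = 1 * 1 := (one_mul 1).symm
          _ ≤ _ := mul_le_mul hα hα' zero_le_one (zero_le_one.trans hα)
  · intro h t ht
    obtain ⟨δ, hδ, c, hc, hn⟩ := h t ht
    -- `δ' = δ/2`, threshold where `c n^{δ/2} ≥ 1`
    obtain ⟨n₀, hn₀⟩ : ∃ n₀ : ℕ, c⁻¹ ^ (2 / δ) ≤ (n₀ : ℝ) := exists_nat_ge _
    refine ⟨δ / 2, half_pos hδ, max n₀ 1, fun n hnn G => ?_⟩
    have hn1 : (1 : ℝ) ≤ n := by exact_mod_cast le_of_max_le_right hnn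
    have hnpos : (0 : ℝ) < n := one_pos.trans_le hn1
    have hcn : 1 ≤ c * (n : ℝ) ^ (δ / 2) := by
      have hn₀n : c⁻¹ ^ (2 / δ) ≤ (n : ℝ) := hn₀.trans (by exact_mod_cast le_of_max_le_left hnn)
      have h2 : (c⁻¹ ^ (2 / δ)) ^ (δ / 2) ≤ (n : ℝ) ^ (δ / 2) :=
        Real.rpow_le_rpow (Real.rpow_nonneg (inv_nonneg.2 hc.le) _) hn₀n (half_pos hδ).le
      rw [← Real.rpow_mul (inv_nonneg.2 hc.le), show 2 / δ * (δ / 2) = 1 by field_simp,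
        Real.rpow_one] at h2
      calc (1 : ℝ) = c * c⁻¹ := (mul_inv_cancel₀ hc.ne').symm
        _ ≤ c * (n : ℝ) ^ (δ / 2) := mul_le_mul_of_nonneg_left h2 hc.le
    calc (n : ℝ) ^ (δ / 2) = 1 * (n : ℝ) ^ (δ / 2) := (one_mul _).symm
      _ ≤ (c * (n : ℝ) ^ (δ / 2)) * (n : ℝ) ^ (δ / 2) :=
          mul_le_mul_of_nonneg_right hcn (Real.rpow_nonneg hnpos.le _)
      _ = c * (n : ℝ) ^ δ := by
          rw [mul_assoc, ← Real.rpow_add hnpos, add_halves]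
      _ ≤ _ := hn n G

/-! ### The trivial floor and the Paley rung -/

/-- The trivial floor `α(G) · α(Gᶜ) ≤ las_t(G) · las_t(Gᶜ)` (`t ≥ 1`; soundness of the hierarchy on
both sides). By Ramsey's theorem the left side is only logarithmic in `n` in general, which is
why `UP_t` is not a consequence of soundness. -/
theorem indepNum_mul_indepNum_compl_le {V : Type} [Fintype V] [DecidableEq V]
    (G : SimpleGraph V) {t : ℕ} (ht : 1 ≤ t) :
    (G.indepNum : ℝ) * (Gᶜ.indepNum : ℝ) ≤ lasserreStableBound G t * lasserreStableBound Gᶜ t :=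
  mul_le_mul (indepNum_le_lasserreStableBound G t ht) (indepNum_le_lasserreStableBound Gᶜ t ht)
    (Nat.cast_nonneg _) (lasserreStableBound_nonneg G t ht)

/-- **The rung implication `SosUncertainty → PaleySosRung`** (route file: `PaleySosRung
[deps: SosUncertainty]`). For a prime `p ≡ 1 (mod 4)` the Paley graph is self-complementary, so
`las_t(P_pᶜ) = las_t(P_p)` (`lasserreStableBound_compl_paleyGraph`) and `UP_t` with exponent `δ`
gives `las_t(P_p)² ≥ p^δ`, i.e. `las_t(P_p) ≥ p^{δ/2}`: take `η = δ/2`, `p₀ = n₀`. -/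
theorem paleySosRung_of_sosUncertainty : SosUncertainty → PaleySosRung := by
  intro h t ht
  obtain ⟨δ, hδ, n₀, hn⟩ := h t ht
  refine ⟨δ / 2, half_pos hδ, n₀, fun p hp hprime h4 => ?_⟩
  have hP := hn p hp (paleyGraph p)
  rw [lasserreStableBound_compl_paleyGraph hprime h4 ht] at hP
  have hlas : 0 ≤ lasserreStableBound (paleyGraph p) t := lasserreStableBound_nonneg _ t ht
  have hp0 : (0 : ℝ) ≤ p := Nat.cast_nonneg _
  have hsq : (p : ℝ) ^ (δ / 2) * (p : ℝ) ^ (δ / 2) = (p : ℝ) ^ δ := by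
    rw [← Real.rpow_add' hp0 (by linarith : δ / 2 + δ / 2 ≠ 0), add_halves]
  rw [paleyGraph_eq_fromRel] at hP hlas
  exact (mul_self_le_mul_self_iff (Real.rpow_nonneg hp0 _) hlas).2 (hsq ▸ hP)

end Summit.PneNP.PneNP.Theorems.SosUncertainty
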